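/-
Copyright (c) 2026 the pub-hodgecm-mathlib formalisation cell (harness21).  Prover seat hodgecm-mathlib-LH4-p11 (g4), req620 Track A «(D-RAM) FOUR-FRAME» squad: the (D-H) leg of the
«DEEP-THRESHOLD BRIDGE» (REF5 (g23) R5-142 recipe) — threshold antitonicity of ★ №2c-R's H-side dictionary `HSideAnchorRowsS`.  2026-09-04.
-/
import Summits.HodgeConjecture.HodgeConjecture.Theorems.F0P3cDyRamFourFrameHSideDefsR   -- ★ №2c-R p855104: `HSideAnchorRowsS shift N₀ τ t`, `HSideAnchorRowsR`; brings ★ №2c, ★ №1-R (`shiftR`), ★ #0a `depthOfRecord`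
import HarnessLib

/-!
# Crux `H413`, line LH4 «(D-RAM) FOUR-FRAME» road — THE DEEP-THRESHOLD BRIDGE, (D-H) LEG: `HSideAnchorRowsS shift N₀ τ t` IS ANTITONE IN THE THRESHOLD SCHEDULE, so U2H's export
# `HSideAnchorRowsR depthOfRecord tauOfRecord 0` (stub #3) serves ★ #11S `anchorRows_of_fourFrameLawsS` at the RAISED threshold `N₀' d' := max (depthOfRecord d') (2 d' − 1 + t)`

Cell `hodgecm-mathlib` (D-0151), FLOOR 0, crux item H413 = `stmt-HodgeConjecture-24833`, route of record `HCCMUnconditional`; squad F0∕P3c∕LH4 (req618∕req620); helper lane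
`--supports stmt-HodgeConjecture-24833 --as helper` (count-neutral).  THEOREMS ONLY (no `def`, no instance, no notation, no `sorry`, default heartbeats).  Sibling of
`Theorems/F0P3cDyRamFourFrameLawsDeepThreshold.lean` (the laws ∕ (D-CΔ) legs); consumer: the tier-0 `stub_rows_unit0 : PieceRowsWild gselStar 0` payer through ★ #11S.

THE POINT.  In ★ №2c-R's (D-H) dictionary `HSideAnchorRowsS shift N₀ τ t` the threshold schedule `N₀` occurs exactly once: row (1) (the law-shaped H-side realisation) quantifies over
element data `IsElementDatum σ_w ϖ (N₀ d) (a², b²) n₁ n₂ n₃` in HYPOTHESIS position; rows (2)(3) and the census tie of the constant `C` are `N₀`-free.  Hence the Prop is ANTITONE in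
`N₀` (a larger threshold only removes rows of row (1)), with the SAME H-family `ψ`, the same coefficients and the same neighbourhoods.  With the laws leg (U3's Ω-aware export read in
★ №1-R's currency at `N₀'`, where `Ω ≡ 1`) and (D-CΔ) at any threshold, every input of ★ #11S is available at `N₀'` at EVERY wild place, covered or not — no Ω in any socket.

WHAT IS PROVED.
* `hSideAnchorRowsS_of_le (shift) (τ) (t) (hle : ∀ d, N₀ d ≤ N₀' d) : HSideAnchorRowsS shift N₀ τ t → HSideAnchorRowsS shift N₀' τ t` (pure plumbing over the binder telescope).
* `hSideAnchorRowsR_of_le` — the same at the re-cut shift `shiftR` (the R-name U2H's stub #3 and ★ #11S use).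
* `hSideAnchorRowsR_deep_of_depthOfRecord (t₀) : HSideAnchorRowsR depthOfRecord τ t → HSideAnchorRowsR (fun d' => max (depthOfRecord d') (2 d' − 1 + t₀)) τ t` — the `hDH` input of
  ★ #11S at the raised threshold of the deep bridge, from U2H's export at the depth of record (`t₀` = the place's `v_E(2)`, fixed at the call site).
HONEST LABEL.  Count-neutral (`--supports`); plumbing only — nothing asserted about (D-H) itself (U2H's debt ∕ ★ payers); `HC_CM` is proved only modulo the 7 printed citations
(2 remaining named inputs: hLiu418 = `stmt-HodgeConjecture-24832`, h413 = `stmt-HodgeConjecture-24833`) until rung 0 closes.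

## References
* [Rogawski1990] J. D. Rogawski, *Automorphic Representations of Unitary Groups in Three Variables*, Ann. of Math. Stud. 123 (1990), §4.9 Prop. 4.9.1 p. 55; §8.1 p. 113.
* [LanglandsShelstad1987] R. P. Langlands, D. Shelstad, *On the definition of transfer factors*, Math. Ann. 278 (1987), §1.3, §3.
-/

set_option autoImplicit false

noncomputable section

namespace Summit.HodgeConjecture.HodgeConjecture.Cruxes.H413.F0P3cDyRamHSideAnchorRowsDeepThreshold

open MeasureTheory Measure NumberField IsDedekindDomain Topology Filter
open Literature.NumberTheory.Automorphic Literature.NumberTheory.Automorphic.UnitaryGroup Literature.NumberTheory.Automorphic.IntegralReduction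
open Literature.NumberTheory.Automorphic.UnitaryLatticeTree Literature.NumberTheory.Automorphic.HermitianLattice
open Literature.NumberTheory.Rogawski1990 Literature.NumberTheory.GaloisRepresentations
open Literature.NumberTheory.Automorphic.UnitaryThreeFourFrame
open scoped Matrix MatrixGroups Classical ValuativeRel WithZero
open Summit.HodgeConjecture.HodgeConjecture.Cruxes.H413.F0P3cDyRamFourFrameHSideDefs
open Summit.HodgeConjecture.HodgeConjecture.Cruxes.H413.F0P3cDyRamFourFrameHSideDefsR
open Summit.HodgeConjecture.HodgeConjecture.Cruxes.H413.F0P3cDyRamFourFrameLawDefsR (shiftR)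

/-- **(D-H)-S IS ANTITONE IN THE THRESHOLD SCHEDULE.**  If `N₀ ≤ N₀'` pointwise, then `HSideAnchorRowsS shift N₀ τ t → HSideAnchorRowsS shift N₀' τ t`: the same H-family,
coefficients and neighbourhoods serve; row (1) at the larger threshold is row (1) at the smaller one restricted to fewer element data (the `IsElementDatum … (N₀ d) …` binder is in
hypothesis position and is the only occurrence of `N₀`); rows (2)(3) are threshold-free. [cite: Rogawski1990, §4.9 Prop. 4.9.1 p. 55] [cite: LanglandsShelstad1987, §1.3] -/
theorem hSideAnchorRowsS_of_le (shift : ℕ → ℕ → ℤ) {N₀ N₀' : ℕ → ℕ} (τ : ℕ → ℤ) (t : ℕ) (hle : ∀ d, N₀ d ≤ N₀' d)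
    (h : HSideAnchorRowsS shift N₀ τ t) : HSideAnchorRowsS shift N₀' τ t := by
  intro L _i1 _i2 _i3 v w hw he h2 ϖ hϖ d tE hD _i4 δ hδ hδ0 μ hμu hμω _i5 _i6 _i7 _i8 _i9 _i10 _i11 _i12 νH _i13 _i14 νG₃ _i15 _i16 mH mG₃ hmH hmG N hN Kt hKt C hC
  obtain ⟨r, ψ, hψ, coef, ⟨V, hV, h1⟩, h2', h3⟩ := h L w hw he h2 ϖ hϖ d tE hD δ hδ hδ0 μ hμu hμω νH νG₃ mH mG₃ hmH hmG N hN Kt hKt C hC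
  refine ⟨r, ψ, hψ, coef, ⟨V, hV, ?_⟩, h2', h3⟩
  intro γH hγ hreg f hf a b z ha hb hz hzγ hra hrb ha1 hb1 n₁ n₂ n₃ hE k hk Γ hΓ tb htb i B hB hNP hrel
  obtain ⟨e1, e2, e3, e4, e5, e6, e7, e8, hN1, hN2, hN3⟩ := hE
  exact h1 γH hγ hreg f hf a b z ha hb hz hzγ hra hrb ha1 hb1 n₁ n₂ n₃
    ⟨e1, e2, e3, e4, e5, e6, e7, e8, (hle d).trans hN1, (hle d).trans hN2, (hle d).trans hN3⟩ k hk Γ hΓ tb htb i B hB hNP hrel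

/-- **(D-H)-R IS ANTITONE IN THE THRESHOLD SCHEDULE** (the re-cut shift `shiftR`; the R-name U2H's stub #3 and ★ #11S at `shiftR` use). [cite: Rogawski1990, §4.9 Prop. 4.9.1 p. 55] -/
theorem hSideAnchorRowsR_of_le {N₀ N₀' : ℕ → ℕ} (τ : ℕ → ℤ) (t : ℕ) (hle : ∀ d, N₀ d ≤ N₀' d)
    (h : HSideAnchorRowsR N₀ τ t) : HSideAnchorRowsR N₀' τ t :=
  hSideAnchorRowsS_of_le shiftR τ t hle h

/-- **THE `hDH` INPUT OF ★ #11S AT THE RAISED THRESHOLD OF THE DEEP BRIDGE**: from U2H's export at the depth of record to the schedule `N₀' d' := max (depthOfRecord d') (2 d' − 1 + t₀)`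
(`t₀` = the current place's `v_E(2)`, fixed at the call site). [cite: Rogawski1990, §4.9 Prop. 4.9.1 p. 55] [cite: LanglandsShelstad1987, §1.3] -/
theorem hSideAnchorRowsR_deep_of_depthOfRecord (τ : ℕ → ℤ) (t t₀ : ℕ) (h : HSideAnchorRowsR depthOfRecord τ t) :
    HSideAnchorRowsR (fun d' => max (depthOfRecord d') (2 * d' - 1 + t₀)) τ t :=
  hSideAnchorRowsR_of_le τ t (fun _ => le_max_left _ _) h

end Summit.HodgeConjecture.HodgeConjecture.Cruxes.H413.F0P3cDyRamHSideAnchorRowsDeepThreshold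

end
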